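import Summits.QuantumFields.YangMills.Theses.CovariantDischarge
import Summits.QuantumFields.YangMills.Theorems.UnitScaleTiltHistoryTailBoundedHeightLocal

/-!
# Route `CovariantDischarge` — its FIRST RUNG `LevelOneWindowTailL` (stmt-QuantumFields-22894) and the bounded-depth regime of line
# «covariant_discharge» (`stub_boundedDepth`) PROVED: the first-exit WINDOW tail at BOUNDED depth, with constants fixed BEFORE the family

Cell `ym3-torus` (YM ladder rung R3 = continuum SU(2) Yang–Mills on the three-torus; NOT the Clay problem), width seat `ym-ust-19936-w2` gen 8 on
the crux `HistoryTailL` (stmt-QuantumFields-19936).  The ideator line «covariant_discharge» (`Cruxes/HistoryTailL/Lines/covariant_discharge.lean`,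
route `CovariantDischarge`, DRAFT) cuts the window tail into four depth ranges: level one (`stub_levelOne : LevelOneWindowTailL`, the route's crux
stmt-QuantumFields-22894, «FIRST RUNG, L»), bounded depth `2 ≤ j ≤ j₀` (`stub_boundedDepth`, «L»), a positive fraction of the depth (XL) and the deep
residual.  THIS FILE proves the first two BY NAME — not by a covariant Cameron–Martin sweep but by LOCALITY: the volume-uniform bounded-height schema
`HistoryTailBoundedHeightLocal.perPlaquette_boundedHeight_uniform` (local crude Prop 1 iterated over a footprint of `≤ (81L³)^j` fine plaquettes +
the per-plaquette reflection-positivity/chessboard bound), whose constants `C = (81L³)^{j₀}·2e^{24}c₀^{−3}·L^{5j₀}`, `N = 5`, `c = ¼(151L²)^{−2j₀}`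
depend on `L` and `j₀` only; the window events are sub-events of the plain per-plaquette tail `{θ(K−j) ≤ |Ū^{j}(∂p) − 1|}` (the history and
`b₂`-conditioner conjuncts are dropped), and `γ₁ := 1`.

* `boundedDepthWindowTail` — the text of `stub_boundedDepth` VERBATIM (every `L, j₀`); `stub_boundedDepth` (exact registered name);
* `levelOneWindowTailL_proof : Theses.CovariantDischarge.LevelOneWindowTailL` (the crux item 22894 BY NAME, `j₀ = 1`); `stub_levelOne` (exact name).

WHAT THIS IS NOT.  Bounded depth only: the constants blow up like `(81L³)^{j₀}` and `(151L²)^{2j₀}`, so nothing is said about the route's load-bearing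
`FractionalWindowTailL` (a positive FRACTION of the depth, stmt-QuantumFields-22891), the residual `DeepWindowTailL`, the crux `HistoryTailL`, the rung
R3, d = 4, a continuum limit or a mass gap.  YM₃ on T³ is rung R3 of the programme, NOT the Clay problem.

References: T. Bałaban, CMP **98** (1985) 17–51 [Balaban1985Averaging] (Prop. 1 (51) p.26); CMP **102** (1985) 255–275 [Balaban1985UV3]
((7) p.257, (11) p.258, (71) p.273).
-/

noncomputable section

open MeasureTheory
open Literature.MathematicalPhysics.QuantumFieldTheory.Balaban1983to89
open Literature.MathematicalPhysics.QuantumFieldTheory.Balaban1983to89.T3ContinuumYM3Torus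
open Literature.MathematicalPhysics.QuantumFieldTheory.Balaban1983to89.T3UnitScaleTilt
open Literature.MathematicalPhysics.QuantumFieldTheory.Balaban1983to89.T3UnitLawDensityEML
open Summit.QuantumFields.YangMills.Theorems.HistoryTailBoundedHeightLocal (perPlaquette_boundedHeight_uniform)

namespace Summit.QuantumFields.YangMills.Theorems.CovariantDischargeBoundedDepthWindowTail

/-- **THE FIRST-EXIT WINDOW TAIL AT BOUNDED DEPTH, CONSTANTS BEFORE THE FAMILY** — the text of `stub_boundedDepth` of line «covariant_discharge»
VERBATIM: for every `L`, `j₀` and profile `(b₀, p₀, b₂)` there are `γ₁ = 1`, `C`, `c > 0`, `N = 5` with, for every family `F` (`F.L = L`), every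
`0 < γ ≤ 1`, every `2 ≤ j ≤ j₀`, `j ≤ K`, every plaquette `p` of `T^{(j)}`:
`Gibbs_K(history small ∧ conditioner small ∧ θ(b₀)(K−j) ≤ |Ū^{j}(∂p) − 1|) ≤ C·β_{K−j}^N·exp(−c·p(g_{K−j})²)` — a sub-event of the plain tail, bounded by
`perPlaquette_boundedHeight_uniform L j₀`. [cite: Balaban1985UV3, (7) p.257 and (71) p.273; Balaban1985Averaging, Prop. 1 (51) p.26] -/
theorem boundedDepthWindowTail :
    open Literature.MathematicalPhysics.QuantumFieldTheory.Balaban1983to89 Literature.MathematicalPhysics.QuantumFieldTheory.Balaban1983to89.T3ContinuumYM3Torus in ∀ (L j₀ : ℕ), ∀ (b₀ p₀ b₂ : ℝ), 0 < b₀ → 2 < p₀ → b₀ ≤ b₂ → ∃ (γ₁ C c : ℝ) (N : ℕ), 0 < γ₁ ∧ γ₁ ≤ 1 ∧ 0 < c ∧ ∀ (F : T3Family) (γ : ℝ), F.L = L → 0 < γ → γ ≤ γ₁ → ∀ (K j : ℕ), 2 ≤ j → j ≤ j₀ → j ≤ K → ∀ p : Plaq (F.P K) j, (T3UnitScaleTilt.gibbsK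 F T3UnitLawDensityEML.ℰp γ K).real {U | (∀ k, k < j → PlaqSmall (T3UnitScaleTilt.θBal F.L γ b₀ p₀ (K - k)) (Averaging.iter (fun i => BlockAveraging.blockAvg (P := F.P K) (j := i) T3UnitLawDensityEML.ℰp) k U)) ∧ PlaqSmall (T3UnitScaleTilt.θBal F.L γ b₂ p₀ (K - j)) (Averaging.iter (fun i => BlockAveraging.blockAvg (P := F.P K) (j := i) T3UnitLawDensityEML.ℰp) j U) ∧ T3UnitScaleTilt.θBal F.L γ b₀ p₀ (K - j) ≤ GaugeGroup.dist1 (GaugeField.plaqHol (Averaging.iter (fun i => BlockAveraging.blockAvg (P := F.P K) (j := i) T3UnitLawDensityEML.ℰp) j U) p)} ≤ C * ((γ * ((F.L : ℝ)⁻¹) ^ (K - j))⁻¹) ^ N * Real.exp (-(c * B10.pFun b₀ p₀ (Real.sqrt (γ * ((F.L : ℝ)⁻¹) ^ (K - j))) ^ 2)) := by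
  intro L j₀ b₀ p₀ b₂ hb₀ _hp₀ _hb₂
  obtain ⟨C, c, _hC, hc, h⟩ := perPlaquette_boundedHeight_uniform L j₀
  refine ⟨1, C, c, 5, one_pos, le_rfl, hc, fun F γ hFL hγ hγ1 K j _hj2 hj0 hjK p => ?_⟩
  haveI := isProbabilityMeasure_gibbsK F ℰp hγ.le K
  have hmain := h F hFL γ hγ hγ1 b₀ hb₀.le p₀ K j hjK hj0 p
  refine le_trans (measureReal_mono (fun U hU => ?_) (measure_ne_top _ _)) hmain
  exact hU.2.2

/-- **THE REGISTERED STUB `stub_boundedDepth` OF LINE «covariant_discharge» BY ITS EXACT NAME AND TYPE.** [cite: Balaban1985UV3, (71) p.273] -/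
theorem stub_boundedDepth :
    open Literature.MathematicalPhysics.QuantumFieldTheory.Balaban1983to89 Literature.MathematicalPhysics.QuantumFieldTheory.Balaban1983to89.T3ContinuumYM3Torus in ∀ (L j₀ : ℕ), ∀ (b₀ p₀ b₂ : ℝ), 0 < b₀ → 2 < p₀ → b₀ ≤ b₂ → ∃ (γ₁ C c : ℝ) (N : ℕ), 0 < γ₁ ∧ γ₁ ≤ 1 ∧ 0 < c ∧ ∀ (F : T3Family) (γ : ℝ), F.L = L → 0 < γ → γ ≤ γ₁ → ∀ (K j : ℕ), 2 ≤ j → j ≤ j₀ → j ≤ K → ∀ p : Plaq (F.P K) j, (T3UnitScaleTilt.gibbsK F T3UnitLawDensityEML.ℰp γ K).real {U | (∀ k, k < j → PlaqSmall (T3UnitScaleTilt.θBal F.L γ b₀ p₀ (K - k)) (Averaging.iter (fun i => BlockAveraging.blockAvg (P := F.P K) (j := i) T3UnitLawDensityEML.ℰp) k U)) ∧ PlaqSmall (T3UnitScaleTilt.θBal F.L γ b₂ p₀ (K - j)) (Averaging.iter (fun i => BlockAveraging.blockAvg (P := F.P K) (j := i) T3UnitLawDensityEML.ℰp) j U) ∧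 T3UnitScaleTilt.θBal F.L γ b₀ p₀ (K - j) ≤ GaugeGroup.dist1 (GaugeField.plaqHol (Averaging.iter (fun i => BlockAveraging.blockAvg (P := F.P K) (j := i) T3UnitLawDensityEML.ℰp) j U) p)} ≤ C * ((γ * ((F.L : ℝ)⁻¹) ^ (K - j))⁻¹) ^ N * Real.exp (-(c * B10.pFun b₀ p₀ (Real.sqrt (γ * ((F.L : ℝ)⁻¹) ^ (K - j))) ^ 2)) :=
  boundedDepthWindowTail

/-- **THE CRUX `LevelOneWindowTailL` (stmt-QuantumFields-22894) OF ROUTE `CovariantDischarge` — ITS «FIRST RUNG» — PROVED**: the window tail of the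
ONCE-averaged `SU(2)` plaquette, uniformly in the cut-off `K ≥ 1`, constants before the family (`γ₁ = 1`, `N = 5`, `C = 81L³·2e^{24}c₀^{−3}·L⁵`,
`c = ¼(151L²)^{−2}`) — `perPlaquette_boundedHeight_uniform L 1` on the sub-event. [cite: Balaban1985UV3, (7) p.257 and (71) p.273; Balaban1985Averaging, Prop. 1 (51) p.26] -/
theorem levelOneWindowTailL_proof : Summit.QuantumFields.YangMills.Theses.CovariantDischarge.LevelOneWindowTailL := by
  unfold Summit.QuantumFields.YangMills.Theses.CovariantDischarge.LevelOneWindowTailL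
  intro L b₀ p₀ b₂ hb₀ _hp₀ _hb₂
  obtain ⟨C, c, _hC, hc, h⟩ := perPlaquette_boundedHeight_uniform L 1
  refine ⟨1, C, c, 5, one_pos, le_rfl, hc, fun F γ hFL hγ hγ1 K j hj1 hK p => ?_⟩
  haveI := isProbabilityMeasure_gibbsK F ℰp hγ.le K
  have hmain := h F hFL γ hγ hγ1 b₀ hb₀.le p₀ K j (by omega) (by omega) p
  refine le_trans (measureReal_mono (fun U hU => ?_) (measure_ne_top _ _)) hmain
  exact hU.2.2

/-- **THE REGISTERED STUB `stub_levelOne` OF LINE «covariant_discharge» BY ITS EXACT NAME AND TYPE** (`= LevelOneWindowTailL`). [cite: Balaban1985UV3, (71) p.273] -/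
theorem stub_levelOne : Summit.QuantumFields.YangMills.Theses.CovariantDischarge.LevelOneWindowTailL :=
  levelOneWindowTailL_proof

end Summit.QuantumFields.YangMills.Theorems.CovariantDischargeBoundedDepthWindowTail

end
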